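import Summits.NavierStokesRegularity.NavierStokesRegularity.Theorems.SqueezeCycleExtremalElementExistsRegularity
import Literature.Analysis.FluidPDE.SpaceTimeCalculus
import HarnessLib

/-!
# Scale-invariant energies pass to the limit (route `SqueezeCycle`, item `ExtremalElementExists`,
# stmt-NavierStokesRegularity-11611)

Helper file for the compactness of the route's Type-I model class `𝒦_C`: if Type-I ancient mild
fields `w k` (common constant `C`) obey the two local energy bounds of the class —
`r⁻¹ ∫_{B(x₀,r)} |w(t)|² ≤ C` for `t ∈ (t₀ - r², t₀)` and `r⁻¹ ∫_{(t₀-r²,t₀)} ∫_{B(x₀,r)} |∇w|² ≤ C`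
for all `x₀`, `t₀ ≤ 0`, `r > 0` — and converge with their gradients pointwise on the open slab to
a field `W` of the class, then `W` obeys the same bounds (`energyBounds_of_tendsto`):
dominated convergence at fixed negative times and on cylinders with vertex time `t₀ < 0` (the
class-uniform gradient bound of `SqueezeCycleExtremalElementExistsRegularity` dominates), and an
exhaustion `(−r², −δ) ↑ (−r², 0)` for the vertex time `t₀ = 0`, where nothing is uniform.
-/

noncomputable section

open MeasureTheory Set Function Filter TopologicalSpace Metric
open scoped Topology NNReal ENNReal

namespace Summit.NavierStokesRegularity.NavierStokesRegularity.Theorems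

open Literature.Analysis Literature.Analysis.FluidPDE

section Limits

variable {F : Type*} [NormedAddCommGroup F]

/-- **Dominated convergence on a ball, squared norms**: if continuous `f j → g` pointwise with
`‖f j‖ ≤ M`, then `∫_{B} ‖f j‖² → ∫_{B} ‖g‖²` on every ball `B`. [folklore] -/
theorem tendsto_setIntegral_ball_norm_sq_of_bound {f : ℕ → EuclideanSpace ℝ (Fin 3) → F}
    {g : EuclideanSpace ℝ (Fin 3) → F} (hf : ∀ j, Continuous (f j)) {M : ℝ}
    (hM : ∀ j x, ‖f j x‖ ≤ M) (hlim : ∀ x, Tendsto (fun j => f j x) atTop (𝓝 (g x)))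
    (x₀ : EuclideanSpace ℝ (Fin 3)) (r : ℝ) :
    Tendsto (fun j => ∫ x in ball x₀ r, ‖f j x‖ ^ 2) atTop (𝓝 (∫ x in ball x₀ r, ‖g x‖ ^ 2)) := by
  refine tendsto_integral_of_dominated_convergence (fun _ => M ^ 2) (fun j => ?_) ?_ (fun j => ?_)
    ?_
  · exact ((hf j).norm.pow 2).aestronglyMeasurable
  · exact integrableOn_const (measure_ball_lt_top.ne) |>.integrable
  · refine Eventually.of_forall fun x => ?_
    rw [Real.norm_eq_abs, abs_of_nonneg (sq_nonneg _)]
    exact pow_le_pow_left₀ (norm_nonneg _) (hM j x) 2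
  · exact Eventually.of_forall fun x => ((hlim x).norm).pow 2

/-- **Continuity in time of the local energy of a jointly continuous field**: if `(t, x) ↦ g t x`
is continuous on `S × ℝ³`, `S` open, then `t ↦ ∫_{B(x₀,r)} ‖g t x‖²` is continuous on `S`
(dominated convergence; the integrand is locally bounded by compactness). [folklore] -/
theorem continuousOn_setIntegral_ball_norm_sq_of_continuousOn {g : ℝ → EuclideanSpace ℝ (Fin 3) → F}
    {S : Set ℝ}
    (hS : IsOpen S) (hg : ContinuousOn (uncurry g) (S ×ˢ univ)) (x₀ : EuclideanSpace ℝ (Fin 3))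
    (r : ℝ) : ContinuousOn (fun t => ∫ x in ball x₀ r, ‖g t x‖ ^ 2) S := by
  intro t₁ ht₁
  -- a compact time neighbourhood `[t₁ - ε, t₁ + ε] ⊆ S`
  obtain ⟨ε, hε, hεS⟩ := Metric.isOpen_iff.1 hS t₁ ht₁
  have hIcc : Icc (t₁ - ε / 2) (t₁ + ε / 2) ⊆ S := fun t ht =>
    hεS (by rw [mem_ball, Real.dist_eq, abs_lt]; constructor <;> linarith [ht.1, ht.2])
  -- bound on the compact set `[t₁ - ε/2, t₁ + ε/2] × B̄(x₀, |r|)`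
  have hK : IsCompact (Icc (t₁ - ε / 2) (t₁ + ε / 2) ×ˢ closedBall x₀ |r|) :=
    isCompact_Icc.prod (isCompact_closedBall _ _)
  obtain ⟨M, hM⟩ := hK.exists_bound_of_continuousOn
    (hg.mono (prod_mono hIcc (subset_univ _)))
  have hnhds : Ioo (t₁ - ε / 2) (t₁ + ε / 2) ∈ 𝓝[S] t₁ :=
    mem_nhdsWithin_of_mem_nhds (Ioo_mem_nhds (by linarith) (by linarith))
  refine ContinuousWithinAt.mono_of_mem_nhdsWithin ?_ hnhds
  have hslice : ∀ t ∈ S, Continuous (g t) := fun t ht =>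
    hg.comp_continuous (continuous_const.prodMk continuous_id) fun x => ⟨ht, mem_univ x⟩
  have key : ContinuousOn (fun t => ∫ x in ball x₀ r, ‖g t x‖ ^ 2)
      (Ioo (t₁ - ε / 2) (t₁ + ε / 2)) := by
    refine continuousOn_of_dominated (bound := fun _ => M ^ 2) (fun t ht => ?_) (fun t ht => ?_)
      ?_ ?_
    · exact (((hslice t (hIcc (Ioo_subset_Icc_self ht))).norm.pow 2)).aestronglyMeasurable
    · refine (ae_restrict_mem measurableSet_ball).mono fun x hx => ?_
      rw [Real.norm_eq_abs, abs_of_nonneg (sq_nonneg _)]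
      have hxK : (t, x) ∈ Icc (t₁ - ε / 2) (t₁ + ε / 2) ×ˢ closedBall x₀ |r| :=
        ⟨Ioo_subset_Icc_self ht, mem_closedBall.2 ((mem_ball.1 hx).le.trans (le_abs_self r))⟩
      have h := hM (t, x) hxK
      have hM0 : 0 ≤ M := (norm_nonneg _).trans h
      exact pow_le_pow_left₀ (norm_nonneg _) h 2
    · exact integrableOn_const (measure_ball_lt_top.ne) |>.integrable
    · refine (ae_restrict_mem measurableSet_ball).mono fun x _ => ?_
      have hcx : ContinuousOn (fun t => g t x) S :=
        hg.comp (continuousOn_id.prodMk continuousOn_const) fun t' ht' => ⟨ht', mem_univ x⟩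
      exact ((hcx.mono (Ioo_subset_Icc_self.trans hIcc)).norm.pow 2)
  exact key t₁ ⟨by linarith, by linarith⟩

/-- **The vertex time `t₀ = 0` by exhaustion**: if `Φ ≥ 0` is continuous on `(-∞, 0)` and
`r⁻¹ ∫_{(t₀ - r², t₀)} Φ ≤ B` for every `t₀ < 0` (`B ≥ 0`, `r > 0`), then also
`r⁻¹ ∫_{(-r², 0)} Φ ≤ B` (monotone convergence along `(−r², −δ) ↑ (−r², 0)`; if `Φ` is not
integrable up to `0` the Bochner integral vanishes). [folklore] -/
theorem scaledIntegral_vertex_zero {Φ : ℝ → ℝ} (hΦc : ContinuousOn Φ (Iio 0))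
    (hΦ0 : ∀ t < 0, 0 ≤ Φ t) {B r : ℝ} (hB : 0 ≤ B) (hr : 0 < r)
    (h : ∀ t₀ < 0, r⁻¹ * ∫ t in Ioo (t₀ - r ^ 2) t₀, Φ t ≤ B) :
    r⁻¹ * ∫ t in Ioo (-r ^ 2) 0, Φ t ≤ B := by
  have hr2 : 0 < r ^ 2 := by positivity
  by_cases hint : IntegrableOn Φ (Ioo (-r ^ 2) 0) volume
  · -- exhaustion `s i = (−r², −r²/(i+2))`
    set δ : ℕ → ℝ := fun i => r ^ 2 / ((i : ℝ) + 2) with hδ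
    have hδpos : ∀ i, 0 < δ i := fun i => by simp only [hδ]; positivity
    have hδlt : ∀ i, δ i < r ^ 2 := fun i => by
      simp only [hδ]
      rw [div_lt_iff₀ (by positivity)]
      nlinarith [(Nat.cast_nonneg i : (0 : ℝ) ≤ i)]
    have hδanti : Antitone δ := fun i j hij => by
      simp only [hδ]
      exact div_le_div_of_nonneg_left hr2.le (by positivity)
        (by exact_mod_cast Nat.add_le_add_right hij 2)
    have hδlim : Tendsto δ atTop (𝓝 0) := by
      have h1 : Tendsto (fun i : ℕ => ((i : ℝ) + 2)⁻¹) atTop (𝓝 0) :=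
        tendsto_inv_atTop_zero.comp
          (tendsto_atTop_add_const_right _ _ tendsto_natCast_atTop_atTop)
      have h2 := h1.const_mul (r ^ 2)
      rw [mul_zero] at h2
      exact h2.congr fun i => by simp only [hδ]; rw [div_eq_mul_inv]
    set s : ℕ → Set ℝ := fun i => Ioo (-r ^ 2) (-δ i) with hs
    have hsmono : Monotone s := fun i j hij => Ioo_subset_Ioo le_rfl (neg_le_neg (hδanti hij))
    have hU : (⋃ i, s i) = Ioo (-r ^ 2) 0 := by
      apply Subset.antisymm
      · exact iUnion_subset fun i => Ioo_subset_Ioo le_rfl (neg_nonpos.2 (hδpos i).le)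
      · intro t ht
        obtain ⟨i, hi⟩ := ((tendsto_order.1 hδlim).2 (-t) (neg_pos.2 ht.2)).exists
        exact mem_iUnion.2 ⟨i, ht.1, by linarith⟩
    have hlim : Tendsto (fun i => ∫ t in s i, Φ t) atTop (𝓝 (∫ t in Ioo (-r ^ 2) 0, Φ t)) := by
      rw [← hU]
      refine tendsto_setIntegral_of_monotone (fun i => measurableSet_Ioo) hsmono ?_
      rwa [hU]
    -- each term is at most `B r`
    have hle : ∀ i, ∫ t in s i, Φ t ≤ r * B := by
      intro i
      have ht₀ : -δ i < 0 := neg_neg_of_pos (hδpos i)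
      have hbig : IntegrableOn Φ (Ioo (-δ i - r ^ 2) (-δ i)) volume := by
        refine (hΦc.mono ?_).integrableOn_compact isCompact_Icc |>.mono_set Ioo_subset_Icc_self
        exact fun t ht => lt_of_le_of_lt ht.2 ht₀
      have hmono : ∫ t in s i, Φ t ≤ ∫ t in Ioo (-δ i - r ^ 2) (-δ i), Φ t := by
        refine setIntegral_mono_set hbig ?_ (Eventually.of_forall fun t ht => ?_)
        · exact (ae_restrict_mem measurableSet_Ioo).mono fun t ht => hΦ0 t (ht.2.trans ht₀)
        · exact ⟨by linarith [ht.1, hδpos i], ht.2⟩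
      have hw := h (-δ i) ht₀
      rw [inv_mul_le_iff₀ hr] at hw
      exact hmono.trans hw
    have hfin : ∫ t in Ioo (-r ^ 2) 0, Φ t ≤ r * B := le_of_tendsto' hlim hle
    rwa [inv_mul_le_iff₀ hr]
  · rw [integral_undef hint, mul_zero]
    exact hB

end Limits

section Class

/-- **The two scale-invariant energy bounds pass to the limit.** Let `w k` be Type-I ancient mild
fields with a common constant `C` obeying the local energy bounds of the route's class `𝒦_C`,
converging with their gradients pointwise on the open slab to a Type-I ancient mild field `W`.
Then `W` obeys the same bounds. [folklore] -/
theorem energyBounds_of_tendsto (C : ℝ)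
    {w : ℕ → ℝ → EuclideanSpace ℝ (Fin 3) → EuclideanSpace ℝ (Fin 3)}
    (hw : ∀ k, IsTypeIAncientMild C (w k))
    (hen : ∀ k (x₀ : EuclideanSpace ℝ (Fin 3)) (t₀ r : ℝ), t₀ ≤ 0 → 0 < r →
      (∀ t, t₀ - r ^ 2 < t → t < t₀ → r⁻¹ * ∫ x in ball x₀ r, ‖w k t x‖ ^ 2 ≤ C) ∧
        r⁻¹ * ∫ t in Ioo (t₀ - r ^ 2) t₀, ∫ x in ball x₀ r, ‖fderiv ℝ (w k t) x‖ ^ 2 ≤ C)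
    {W : ℝ → EuclideanSpace ℝ (Fin 3) → EuclideanSpace ℝ (Fin 3)} (hW : IsTypeIAncientMild C W)
    (hpt : ∀ t < 0, ∀ x, Tendsto (fun k => w k t x) atTop (𝓝 (W t x)))
    (hptG : ∀ t < 0, ∀ x, Tendsto (fun k => fderiv ℝ (w k t) x) atTop (𝓝 (fderiv ℝ (W t) x))) :
    ∀ (x₀ : EuclideanSpace ℝ (Fin 3)) (t₀ r : ℝ), t₀ ≤ 0 → 0 < r →
      (∀ t, t₀ - r ^ 2 < t → t < t₀ → r⁻¹ * ∫ x in ball x₀ r, ‖W t x‖ ^ 2 ≤ C) ∧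
        r⁻¹ * ∫ t in Ioo (t₀ - r ^ 2) t₀, ∫ x in ball x₀ r, ‖fderiv ℝ (W t) x‖ ^ 2 ≤ C := by
  have hC : 0 ≤ C := hW.nonneg
  -- per-`k` facts
  have hc : ∀ k, ContinuousOn (uncurry (w k)) (Iio 0 ×ˢ univ) := fun k =>
    (hw k).continuousOn_uncurry
  have hdivw : ∀ k, ∀ t < 0, IsWeaklyDivFree (w k t) := fun k t ht => (hw k).isWeaklyDivFree ht
  have hmild : ∀ k, ∀ s t : ℝ, s < t → t < 0 → ∀ x,
      w k t x = UnboundedOperators.heatExtension (w k s) (t - s) x -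
        oseenDuhamel 1 s (w k) (w k) t x :=
    fun k s t hst ht x => (hw k).mild_eq_heatExtension hst ht x
  have hI : ∀ k, HasTypeITimeDecay C (w k) := fun k => (hw k).hasTypeITimeDecay
  have hDc : ∀ k, ContinuousOn (fun z : ℝ × EuclideanSpace ℝ (Fin 3) => fderiv ℝ (w k z.1) z.2)
      (Iio 0 ×ˢ univ) := fun k =>
    IsSmoothSpaceTimeOn.continuousOn_fderiv_slice (S := Iio 0) (w := w k) (hw k).contDiffOn
      isOpen_Iio.uniqueDiffOn
  have hWDc : ContinuousOn (fun z : ℝ × EuclideanSpace ℝ (Fin 3) => fderiv ℝ (W z.1) z.2)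
      (Iio 0 ×ˢ univ) :=
    IsSmoothSpaceTimeOn.continuousOn_fderiv_slice (S := Iio 0) (w := W) hW.contDiffOn
      isOpen_Iio.uniqueDiffOn
  -- the energy at a fixed negative time
  have hA : ∀ (x₀ : EuclideanSpace ℝ (Fin 3)) (t₀ r : ℝ), t₀ ≤ 0 → 0 < r →
      ∀ t, t₀ - r ^ 2 < t → t < t₀ → r⁻¹ * ∫ x in ball x₀ r, ‖W t x‖ ^ 2 ≤ C := by
    intro x₀ t₀ r ht₀ hr t ht1 ht2
    have ht : t < 0 := lt_of_lt_of_le ht2 ht₀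
    have hlim := (tendsto_setIntegral_ball_norm_sq_of_bound
      (fun k => (hw k).continuous_slice ht)
      (fun k x => (hI k) t ht x) (hpt t ht) x₀ r).const_mul r⁻¹
    exact le_of_tendsto' hlim fun k => (hen k x₀ t₀ r ht₀ hr).1 t ht1 ht2
  -- the dissipation on cylinders with vertex time `t₀ < 0`
  have hEneg : ∀ (x₀ : EuclideanSpace ℝ (Fin 3)) (t₀ r : ℝ), t₀ < 0 → 0 < r →
      r⁻¹ * ∫ t in Ioo (t₀ - r ^ 2) t₀, ∫ x in ball x₀ r, ‖fderiv ℝ (W t) x‖ ^ 2 ≤ C := by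
    intro x₀ t₀ r ht₀ hr
    -- class-uniform gradient bound on the window `[t₀ - r², t₀/2)`
    obtain ⟨K, hK⟩ := exists_norm_iteratedFDeriv_le_of_typeI C 1 (a := t₀ - r ^ 2 - 1)
      (b := t₀ / 2) (δ := 1) (by linarith [sq_nonneg r]) (by linarith) one_pos
    have hKw : ∀ k, ∀ t ∈ Ioo (t₀ - r ^ 2) t₀, ∀ x, ‖fderiv ℝ (w k t) x‖ ≤ K := by
      intro k t ht x
      have h := hK (hc k) (hdivw k) (hmild k) (hI k) t ⟨by linarith [ht.1], by linarith [ht.2]⟩ x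
      rwa [norm_iteratedFDeriv_one] at h
    -- inner integrals converge at every time of the window
    set Φ : ℕ → ℝ → ℝ := fun k t => ∫ x in ball x₀ r, ‖fderiv ℝ (w k t) x‖ ^ 2 with hΦ
    set Ψ : ℝ → ℝ := fun t => ∫ x in ball x₀ r, ‖fderiv ℝ (W t) x‖ ^ 2 with hΨ
    have hinner : ∀ t ∈ Ioo (t₀ - r ^ 2) t₀, Tendsto (fun k => Φ k t) atTop (𝓝 (Ψ t)) := by
      intro t ht
      have ht' : t < 0 := ht.2.trans ht₀
      have hcont : ∀ k, Continuous (fderiv ℝ (w k t)) := fun k =>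
        ((hw k).contDiff_slice ht').continuous_fderiv (by simp)
      exact tendsto_setIntegral_ball_norm_sq_of_bound hcont (fun k x => hKw k t ht x) (hptG t ht')
        x₀ r
    -- continuity (hence measurability) of the inner integrals in time
    have hΦc : ∀ k, ContinuousOn (Φ k) (Iio 0) := fun k =>
      continuousOn_setIntegral_ball_norm_sq_of_continuousOn (g := fun t x => fderiv ℝ (w k t) x)
        isOpen_Iio (hDc k) x₀ r
    -- dominated convergence in time
    set Vc : ℝ := ∫ x in ball x₀ r, (K ^ 2 : ℝ) with hVc
    have hΦbd : ∀ k, ∀ t ∈ Ioo (t₀ - r ^ 2) t₀, ‖Φ k t‖ ≤ Vc := by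
      intro k t ht
      have ht' : t < 0 := ht.2.trans ht₀
      have h0 : 0 ≤ Φ k t := setIntegral_nonneg measurableSet_ball fun x _ => sq_nonneg _
      rw [Real.norm_eq_abs, abs_of_nonneg h0]
      have hgi : IntegrableOn (fun x => ‖fderiv ℝ (w k t) x‖ ^ 2) (ball x₀ r) volume :=
        ((((hw k).contDiff_slice ht').continuous_fderiv (by simp)).norm.pow 2).continuousOn
          |>.integrableOn_compact (isCompact_closedBall x₀ r) |>.mono_set ball_subset_closedBall
      exact setIntegral_mono_on hgi (integrableOn_const (measure_ball_lt_top).ne)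
        measurableSet_ball fun x _ => pow_le_pow_left₀ (norm_nonneg _) (hKw k t ht x) 2
    have hlimT : Tendsto (fun k => ∫ t in Ioo (t₀ - r ^ 2) t₀, Φ k t) atTop
        (𝓝 (∫ t in Ioo (t₀ - r ^ 2) t₀, Ψ t)) := by
      refine tendsto_integral_of_dominated_convergence (fun _ => Vc) (fun k => ?_) ?_ (fun k => ?_)
        ?_
      · exact ((hΦc k).mono fun t ht => ht.2.trans ht₀).aestronglyMeasurable measurableSet_Ioo
      · exact (integrableOn_const (measure_Ioo_lt_top).ne).integrable
      · exact (ae_restrict_mem measurableSet_Ioo).mono fun t ht => hΦbd k t ht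
      · exact (ae_restrict_mem measurableSet_Ioo).mono fun t ht => hinner t ht
    exact le_of_tendsto' (hlimT.const_mul r⁻¹) fun k => (hen k x₀ t₀ r ht₀.le hr).2
  -- assembly, with the vertex time `t₀ = 0` by exhaustion
  intro x₀ t₀ r ht₀ hr
  refine ⟨hA x₀ t₀ r ht₀ hr, ?_⟩
  rcases lt_or_eq_of_le ht₀ with hlt | heq
  · exact hEneg x₀ t₀ r hlt hr
  · subst heq
    have hΨc : ContinuousOn (fun t => ∫ x in ball x₀ r, ‖fderiv ℝ (W t) x‖ ^ 2) (Iio 0) :=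
      continuousOn_setIntegral_ball_norm_sq_of_continuousOn (g := fun t x => fderiv ℝ (W t) x)
        isOpen_Iio hWDc x₀ r
    have h := scaledIntegral_vertex_zero hΨc
      (fun t _ => setIntegral_nonneg measurableSet_ball fun x _ => sq_nonneg _) hC hr
      (fun t₁ ht₁ => hEneg x₀ t₁ r ht₁ hr)
    rwa [zero_sub]

end Class

end Summit.NavierStokesRegularity.NavierStokesRegularity.Theorems

end
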